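/-
Copyright (c) 2026 the pub-hodgecm-mathlib formalisation cell (harness21).  Prover seat hodgecm-mathlib-K2Liu-p02 (g7), Track B «K2-LIT» ∕ hLiu418
#184♮, #42S payer road (σ), V5-inst (f) PART 2b file 2d — (C) THE SPLITTING SCALAR IS `1` at the splitting of record, and the scalar-free `hN`
socket of `faceA4R_two_of_record` (K2Liu-p02 (g7) bus 15:3xZ; LEAD BATCH #16 «`c ≡ 1` forced»).  THEOREMS ONLY.
-/
import Summits.HodgeConjecture.HodgeConjecture.Theorems.K2LiuA7ValueUnipotentLaw            -- ★ p861010 (`exists_toRep_nDeltaLoc_apply_one`)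
import Summits.HodgeConjecture.HodgeConjecture.Theorems.K2LiuA7ValueInstanceSiegelLaw       -- ★ I-3c (`swSectionDelta_transport_mem_localDegPS`; record datum `finSplittings`)
import Literature.NumberTheory.Automorphic.LocalPiSchwartzBruhatFourier                    -- ★ `piPrimePowBall`, `indicator_piPrimePowBall_mem_schwartzBruhat`, `zero_mem_piPrimePowBall`
import HarnessLib

/-!
# Crux `HLiu418`, (σ) V5-inst (f), file 2d: (C) THE SPLITTING SCALAR OF `N_Δ` IS `1` — THE SCALAR-FREE UNIPOTENT LAW `hN` AT THE SPLITTING OF RECORD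

Cell `hodgecm-mathlib`, crux item hLiu418 = `stmt-HodgeConjecture-24832`; squad K2 ∕ K2Liu; prover K2Liu-p02 (g7).  THEOREMS ONLY (no `def`, no instance, no notation,
no named-fact hypothesis, no `sorry`); lane `--supports stmt-HodgeConjecture-24832 --as helper`.  Record binders verbatim as ★ I-3c `K2LiuA7ValueInstanceSiegelLaw` ∕ the
assembly ★ I-4b `faceA4R_two_of_record`: `χ 𝔪 𝓕` (the FinLocalFamily of the big datum), `μ`, `Γ hΓ hΓ0` (★ β-3), `s𝔻 := (finSplittings …).s v`,
`s^Δ_B := mpTransportLoc Γ ∘ s𝔻 ∘ tensorEmbLoc`.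

THE ARGUMENT (no character theory).  ★ p861010: `(ω^Δ(s^Δ_B (nΔ η)) Φ)(x) = c · ψ_v(η ⬝ᵥ qHerm x) · Φ(x)`, `c ∈ ℂˣ`.  Evaluate at `x = 0` on the unit-box indicator `Ψ₀`
(`Ψ₀(0) = 1`): the left side is the face's big section `f^Δ_{Ψ₀}(nΔ η) = swSectionDelta … s^Δ_B Ψ₀ (nΔ η)`, a SIEGEL SECTION on the small group (★ I-3c
`swSectionDelta_transport_mem_localDegPS`), hence left-`N_Δ`-invariant (★ `IsLocalSiegelSection.apply_unipDeltaLocal_mul`): `f(nΔ η) = f(1) = Ψ₀(0)`; the right side is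
`c · ψ_v(0) · Ψ₀(0) = c` (`qHerm 0 = 0`).  So `c = 1`: **`toRep_nDeltaLoc_apply`** — the `hN` socket of `faceA4R_two_of_record`, scalar-free, LITERALLY:
`(ω u := toRep (localSchrodingerDelta big) (s^Δ_B u))`, `nΔ := nDeltaLoc`, `q := qHerm`, `ψ := adeleAddCharAt (Fp L) v`.
References: [Kudla1994] §3 Thm. 3.1; [KudlaRallis1994] §1; [HarrisKudlaSweet1996] §1 (1.15); [MoeglinVignerasWaldspurger1987] Chap. 2 II.1 (B), II.6.
HONEST LABEL.  Count-neutral helper: `HC_CM` is proved only modulo the 7 printed citations (2 remaining named inputs: hLiu418 = `stmt-HodgeConjecture-24832`,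
h413 = `stmt-HodgeConjecture-24833`) until rung 0 closes.
-/

set_option autoImplicit false
set_option linter.dupNamespace false -- the mandated namespace repeats `HodgeConjecture.HodgeConjecture`
set_option synthInstance.maxHeartbeats 200000 -- rectangular matrix products over the Π-type `L ⊗ L⁺_v` (as ★ p860598)

noncomputable section

open scoped Matrix
open Matrix Topology
open NumberField IsDedekindDomain MeasureTheory
open Literature.NumberTheory.Automorphic Literature.NumberTheory.Automorphic.UnitaryGroup Literature.NumberTheory.GaloisRepresentations
open Literature.NumberTheory.GelbartRogawski1991 Literature.NumberTheory.GelbartRogawski1991.GRConstruction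
open Literature.NumberTheory.GelbartRogawski1991.UnitaryDualPair
open Literature.NumberTheory.GelbartRogawski1991.UnitaryDualPair.LocalSplitting
open Literature.NumberTheory.K2Lit.SiegelDoubled Literature.NumberTheory.K2Lit.LocalSiegelDoubled
open Literature.RepresentationTheory.HeisenbergGroup Literature.RepresentationTheory.HarrisKudlaSweet1996
open Summit.HodgeConjecture.HodgeConjecture.Cruxes.HLiu418.K2LiuLocalSWSectionDefs
open Summit.HodgeConjecture.HodgeConjecture.Cruxes.HLiu418.K2LiuDoublingSchrodingerModelDefs
open Summit.HodgeConjecture.HodgeConjecture.Cruxes.HLiu418.K2LiuDeltaModelRealFrame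
open Summit.HodgeConjecture.HodgeConjecture.Cruxes.HLiu418.K2LiuA7ValueUnipotentPins
open Summit.HodgeConjecture.HodgeConjecture.Cruxes.HLiu418.K2LiuA7ValueUnipotentPinsHerm
open Summit.HodgeConjecture.HodgeConjecture.Cruxes.HLiu418.K2LiuA7ValueUnipotentPinsN
open Summit.HodgeConjecture.HodgeConjecture.Cruxes.HLiu418.K2LiuA7ValueUnipotentLaw
open Summit.HodgeConjecture.HodgeConjecture.Cruxes.HLiu418.K2LiuA7ValueInstanceSiegelLaw

namespace Summit.HodgeConjecture.HodgeConjecture.Cruxes.HLiu418.K2LiuA7ValueUnipotentLawRecord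

variable (L : Type) [Field L] [NumberField L] [IsCMField L] [Algebra.IsQuadraticExtension (Fp L) L]
variable {N M : ℕ} (e : Fin N × Fin M ≃ Fin 2)
  (dV : Fin N → L) (hdV : ∀ i, IsCMField.complexConj L (dV i) = dV i) (hdV0 : ∀ i, dV i ≠ 0)
  (dW : Fin M → L) (hdW : ∀ i, IsCMField.complexConj L (dW i) = dW i) (hdW0 : ∀ i, dW i ≠ 0)
variable {M₂ M' n' : ℕ} (eW : Fin M × Fin M₂ ≃ Fin M') (e' : Fin N × Fin M' ≃ Fin n')
  (dV' : Fin M₂ → L) (hdV' : ∀ k, IsCMField.complexConj L (dV' k) = dV' k) (hdV'0 : ∀ k, dV' k ≠ 0)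
variable (χ : HeckeCharacter L) (𝔪 : ∀ v, PlaceMeasure L v)
  (𝓕 : FinLocalFamily L e' dV hdV hdV0 (tensorFrame L dW eW dV') (tensorFrame_real L dW hdW eW dV' hdV') (tensorFrame_ne_zero L dW eW dV' hdW0 hdV'0) χ 𝔪)
  (v : HeightOneSpectrum (𝓞 (Fp L)))
  [MeasurableSpace (Fin n' → v.adicCompletion (Fp L))] [BorelSpace (Fin n' → v.adicCompletion (Fp L))]
  (μ : Measure (Fin n' → v.adicCompletion (Fp L))) [μ.IsAddHaarMeasure]
  (Γ : SchwartzBruhat (Fin (n' + n') → v.adicCompletion (Fp L)) ≃ₗ[ℂ] SchwartzBruhat (Fin (n' + n') → v.adicCompletion (Fp L)))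
  (hΓ : IsDeltaIntertwiner L e' dV hdV (tensorFrame L dW eW dV') (tensorFrame_real L dW hdW eW dV' hdV') v Γ)
  (hΓ0 : ∀ Ψ : SchwartzBruhat (Fin (n' + n') → v.adicCompletion (Fp L)),
    ((Γ Ψ : SchwartzBruhat (Fin (n' + n') → v.adicCompletion (Fp L))) : (Fin (n' + n') → v.adicCompletion (Fp L)) → ℂ) 0 =
      diagIntegral (GRConstruction.e₂ (n := n')) μ Ψ)

omit [MeasurableSpace (Fin n' → v.adicCompletion (Fp L))] [BorelSpace (Fin n' → v.adicCompletion (Fp L))] in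
include hdV' in
/-- `qHerm 0 = 0` (the Gram matrix of the zero pair). [folklore] -/
theorem qHerm_zero : qHerm L (complexConj_imagUnit L) (imagUnit_ne_zero L) e eW e' dV' v (0 : Fin (n' + n') → v.adicCompletion (Fp L)) = 0 := by
  rw [qHerm_eq_zero_iff L (complexConj_imagUnit L) (imagUnit_ne_zero L) e eW e' dV' hdV' v, map_zero, gramLoc]
  have h0 : bmat L e eW e' v (0 : Fin n' → LocalRing L v) = 0 := Matrix.ext fun i k => rfl
  rw [h0, Matrix.transpose_zero, Matrix.mul_zero]

set_option maxHeartbeats 8000000 in -- measured: the record splitting `finSplittings … .s v` over the Mp-level terms unfolds slowly (★ I-4b: 1.6M ∕ 119 s)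
include hdV' hΓ0 in
/-- **(C) + `hN`: THE SCALAR-FREE UNIPOTENT LAW AT THE SPLITTING OF RECORD** — for every `η`, `Φ`, `x`:
`(ω^Δ(s^Δ_B (nΔ η)) Φ)(x) = ψ_v(η ⬝ᵥ qHerm x) · Φ(x)` (★ p861010 up to `c`; `c = 1` by evaluating the face's big Siegel section ★ I-3c at `nΔ η` and `1` on the unit-box indicator).
The `hN` socket of `faceA4R_two_of_record` with `ι := Fin 4`, `nΔ := nDeltaLoc`, `q := qHerm`, `ψ := adeleAddCharAt (Fp L) v`. [cite: Kudla1994, §3 Thm. 3.1] [cite: KudlaRallis1994, §1]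
[cite: HarrisKudlaSweet1996, §1 (1.15)] -/
theorem toRep_nDeltaLoc_apply (hM₂ : M₂ ≠ 0) (η : Fin 4 → v.adicCompletion (Fp L)) (Φ : SchwartzBruhat (Fin (n' + n') → v.adicCompletion (Fp L)))
    (x : Fin (n' + n') → v.adicCompletion (Fp L)) :
    ((MpPsi.toRep (localSchrodingerDelta L e' dV hdV (tensorFrame L dW eW dV') (tensorFrame_real L dW hdW eW dV' hdV') v)
        (((mpTransportLoc L e' dV hdV (tensorFrame L dW eW dV') (tensorFrame_real L dW hdW eW dV' hdV') v Γ hΓ).toMonoidHom.comp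
          (((finSplittings L e' dV hdV hdV0 (tensorFrame L dW eW dV') (tensorFrame_real L dW hdW eW dV' hdV') (tensorFrame_ne_zero L dW eW dV' hdW0 hdV'0) χ 𝔪 𝓕).s v).comp
            (tensorEmbLoc L e dV hdV dW hdW eW e' dV' hdV' v))) (nDeltaLoc L e dV hdV dW hdW v hdV0 hdW0 η)) Φ :
        SchwartzBruhat (Fin (n' + n') → v.adicCompletion (Fp L))) : (Fin (n' + n') → v.adicCompletion (Fp L)) → ℂ) x =
      (((adeleAddCharAt (Fp L) v) (η ⬝ᵥ qHerm L (complexConj_imagUnit L) (imagUnit_ne_zero L) e eW e' dV' v x) : Circle) : ℂ) *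
        (Φ : (Fin (n' + n') → v.adicCompletion (Fp L)) → ℂ) x := by
  have hsproj := fun g => (finSplittings L e' dV hdV hdV0 (tensorFrame L dW eW dV') (tensorFrame_real L dW hdW eW dV' hdV')
    (tensorFrame_ne_zero L dW eW dV' hdW0 hdV'0) χ 𝔪 𝓕).proj_s v g
  obtain ⟨c, hc⟩ := exists_toRep_nDeltaLoc_apply_one L e dV hdV hdV0 dW hdW hdW0 eW e' dV' hdV' hdV'0 v Γ hΓ
    ((finSplittings L e' dV hdV hdV0 (tensorFrame L dW eW dV') (tensorFrame_real L dW hdW eW dV' hdV') (tensorFrame_ne_zero L dW eW dV' hdW0 hdV'0) χ 𝔪 𝓕).s v)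
    hsproj η
  -- the unit-box indicator `Ψ₀`, `Ψ₀(0) = 1`
  set Ψ₀ : SchwartzBruhat (Fin (n' + n') → v.adicCompletion (Fp L)) :=
    ⟨(piPrimePowBall (v.adicCompletion (Fp L)) (Fin (n' + n')) 0).indicator fun _ => (1 : ℂ), indicator_piPrimePowBall_mem_schwartzBruhat 0 1⟩ with hΨ₀
  have hΨ₀0 : (Ψ₀ : (Fin (n' + n') → v.adicCompletion (Fp L)) → ℂ) 0 = 1 := by
    simp only [hΨ₀, Set.indicator_of_mem (zero_mem_piPrimePowBall (F := v.adicCompletion (Fp L)) (ι := Fin (n' + n')) 0)]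
  -- the face's big section at `Ψ₀` is a Siegel section on the small group (★ I-3c), hence `N_Δ`-invariant
  have hmem := swSectionDelta_transport_mem_localDegPS L e dV hdV hdV0 dW hdW hdW0 eW e' dV' hdV' hdV'0 χ 𝔪 𝓕 v μ Γ hΓ hΓ0 hM₂ Ψ₀
  have h01 := apply_unipDeltaLocal_mul hmem.1 (nDeltaLoc_mem_unipDeltaLocal L e dV hdV hdV0 dW hdW hdW0 v η)
    (1 : UnitaryGroup.localPi L (IsCMField.complexConj L) (2 + 2) (hermD L e dV hdV dW hdW) v)
  rw [mul_one, swSectionDelta_apply, swSectionDelta_apply, map_one, map_one, Module.End.one_apply] at h01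
  -- `h01 : (ω(s^Δ_B (nΔ η)) Ψ₀)(0) = Ψ₀(0)`; compare with ★ p861010 at `(Ψ₀, 0)`
  have hleft := hc Ψ₀ 0
  have hcomb : (c : ℂ) * (((adeleAddCharAt (Fp L) v) (η ⬝ᵥ qHerm L (complexConj_imagUnit L) (imagUnit_ne_zero L) e eW e' dV' v 0) : Circle) : ℂ) *
      (Ψ₀ : (Fin (n' + n') → v.adicCompletion (Fp L)) → ℂ) 0 = (Ψ₀ : (Fin (n' + n') → v.adicCompletion (Fp L)) → ℂ) 0 :=
    hleft.symm.trans h01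
  rw [qHerm_zero L e eW e' dV' hdV' v, dotProduct_zero, AddChar.map_zero_eq_one, Circle.coe_one, mul_one, hΨ₀0, mul_one] at hcomb
  rw [hc Φ x, hcomb, one_mul]

end Summit.HodgeConjecture.HodgeConjecture.Cruxes.HLiu418.K2LiuA7ValueUnipotentLawRecord

end
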